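import Summits.QuantumFields.YangMills.Theorems.BalabanUVNodesN22JointChartsOfActivityJointHolo
import Literature.Analysis.Complex.OsgoodSeparate

/-!
# BalabanUVNodes ∕ node N22 = NE9 — THE ANALYTIC ROAD FROM SEPARATELY HOLOMORPHIC ACTIVITY CHARTS (OSGOOD): activity charts holomorphic
# in the young coupling at each complex probe field, holomorphic in the field at each coupling, and jointly continuous ⟹ the JOINT charts of `…N22JointChartsOfActivityJointHolo`
# (the tree's Osgood lemma `Literature.Analysis.Complex.SCV.differentiableOn_prod_of_separately`; the complexified probe space is finite-dimensional), hence K3 §2b's `h9`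

WIDTH SEAT dag-n22-w1 (harness re-seat g5), piece C9 of its own lineage (C1 `…N22WindowedTwoConstants` → C2 `…N22KernelFadingOfStepRateTwoConstants` → C3
`…N22WindowedCouplingHoloOfJointHolo` → C4 `…N22WindowedCouplingHoloOfLocalTerms` → C6 `…N22JointChartsOfActivityJointHolo`; C5∕C7 model inhabitants; C8 the reality-binder
reduction).  Cell `pub-ymgap`, HUMAN RULING D-0062 (Track A) ∕ D-0149; `--kind proof --supports stmt-QuantumFields-27366 --as helper` (K3⁸ `SpineGivenEndpointR13SepCoPHV`, KEY
MAP v2), COUNT-NEUTRAL.  THEOREMS ONLY (0 `def`, 0 `sorry`, standard axioms).  Imports C6 (p631151) and the tree's OSGOOD LEMMA `Literature/Analysis/Complex/OsgoodSeparate`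
(`Literature.Analysis.Complex.SCV.differentiableOn_prod_of_separately`, everything proved there) only.  Nothing re-declared.

WHY.  C6 §2∕§3 ask JOINT (young coupling, field) holomorphy of the activity charts `ℋ K k h m X Z : ℂ × Ec K k → ℂ` on `Dt × ball(0, R)` — «DISPLAYED, not printed»: [I] p. 263 ∕
§2 p. 266 print analyticity IN THE COUPLING («analytic functions of the effective coupling constants») and [II] p. 15 analyticity IN THE CONFIGURATION («the activities … are
analytic functions of (𝐔, 𝐉)») — SEPARATELY.  The complexified probe spaces `Ec K k` of every producer in the tree are `Fin d → Site_{k+1} → ℂ`-type, hence FINITE-DIMENSIONAL,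
and for a finite-dimensional block Osgood's lemma (continuity + separate holomorphy ⟹ joint holomorphy) is a TREE THEOREM.  So the joint-chart binder of the analytic road can be
WEAKENED to: holomorphic in the young coupling at each complex probe field + holomorphic in the field at each coupling — the (2.38) bound the road already displays makes the
charts jointly continuous (Cauchy estimate ⇒ uniformly Lipschitz slices), which is all Osgood needs (the unbounded statement would be Hartogs' theorem, not in the tree).

WHAT (all [folklore]; by-name compositions).  §1 `differentiableOn_prod_ball_of_separately` — the tree's Osgood lemma unfolded on a product `Dt × ball(0, R)` (`Dt` open, `P`
finite-dimensional); ★ `continuousOn_prod_ball_of_separately_of_bound` (bounded + separately holomorphic ⟹ jointly continuous) and `differentiableOn_prod_ball_of_separately_of_bound`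
(Osgood with the bound in place of continuity).  §2 ★★ `jointCharts_of_activitySepCharts` — C6 §2 with `hℋ` REPLACED by `hℋτ` (∀ v ∈ ball, `τ ↦ ℋ(τ,v)` holomorphic on `Dt`) + `hℋv` (∀ τ ∈ Dt, `v ↦ ℋ(τ,v)` holomorphic on the ball), under `[FiniteDimensional ℂ (Ec K k)]`; same conclusion (the three OUTPUT-chart binders for `𝒢 := locE ∘ ℋ`,
letters `(e·9·64·K₀(64,8)²·A, r₁)`).  §3 ★★★ `ne9_EA_objectsOfRecord₁₃_of_kernelStepRate_activitySepCharts` (C6 §3 in the separate currency ⟹ `NE9 ((objectsOfRecord₁₃ F N θ ℓ).EA 0)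
(Window θ.γ) ℓ.κ ℓ.moduli`) and its pin face `n22At_rateCarriers_of_kernels_pin_of_kernelStepRate_activitySepCharts` (`N22At (rateCarriersOfRecord₁₃CoPH 𝔯 F θ hP g₀ os k).u3`, every
`k`).  The sequel (after C8b `…LocalTermsRe` lands) removes the reality binder `hIm` from this face as well.

HONEST FRAMING (binding).  A hypothesis WEAKENING of ROAD 3's record face (count-neutral helper): N18's kernel step rate (NE5 NOT PRINTED for d = 4), the uniform decay, (1.21),
W1-20's law, the separately-holomorphic activity charts with (2.38) on complex discs (a LOCATED reading of [I] p. 263∕266 + [II] p. 15, NOT a printed display), Road 1's numerals,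
reality, readings ∕ tails and the rows remain BINDERS met by no object of record here; nothing of Bałaban's asserted or constructed; N22 NOT discharged (typed 28∕28 · discharged
5∕27 UNCHANGED — the chair's single count line is the only count); K3⁸ OPEN, NOT claimed, no stub touched; one finite 𝕋⁴ programme at fixed ε — R4 closes the CONDITIONAL rung
`BalabanLadder.UV` only; NOTHING about the continuum limit, ℝ⁴, OS axioms, a mass gap or the Clay problem is proved or claimed.  References (TYPES only): [I] = Bałaban, CMP 109
(1987) p. 263, (1.18)–(1.21) p. 264, §2 p. 266, p. 282; [II] = CMP 116 (1988) (2.13)–(2.14) pp. 14–15, Lemma 3 (2.38) p. 20; Osgood's lemma: Hörmander, *An Introduction to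
Complex Analysis in Several Variables* §2.2 [HormanderSCV1973] (tree theorem).
-/

noncomputable section

open Filter Topology Set Metric
open scoped BigOperators ComplexConjugate

namespace YMDAG.N22.JointHoloLocalTerms

open Literature.MathematicalPhysics.QuantumFieldTheory.Balaban1983to89
open Literature.MathematicalPhysics.QuantumFieldTheory.Balaban1983to89.T4Continuum (T4Family ULoop)
open Literature.MathematicalPhysics.QuantumFieldTheory.Balaban1983to89.T4OutputRate (Window NE9 DecayBound)
open Literature.MathematicalPhysics.QuantumFieldTheory.Balaban1983to89.TreeLengthTorus (TPt tsys torusTreeLen torusTreeLen_nonneg)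
open Literature.MathematicalPhysics.QuantumFieldTheory.Balaban1983to89.TreeLengthTorusGeometry (TTouch)
open Literature.MathematicalPhysics.QuantumFieldTheory.Balaban1983to89.B12TreeDecay (K₀ kappa₀ K₀_pos)
open Literature.MathematicalPhysics.QuantumFieldTheory.Balaban1983to89.B12Decay510 (delta1)
open Literature.MathematicalPhysics.QuantumFieldTheory.Balaban1983to89.B12Decay510Window (K₁ K₁_nonneg)
open Literature.MathematicalPhysics.QuantumFieldTheory.Balaban1983to89.B12Decay510Torus (distCT nearT)
open Literature.MathematicalPhysics.QuantumFieldTheory.Balaban1983to89.B13Resummation (locE locE_congr)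
open Literature.MathematicalPhysics.QuantumFieldTheory.Balaban1983to89.Node00
open Literature.MathematicalPhysics.QuantumFieldTheory.Balaban1983to89.Node00.Sect2 (domSys domCount CPair)
open Literature.MathematicalPhysics.QuantumFieldTheory.Balaban1983to89.Node00.W1
open Literature.MathematicalPhysics.QuantumFieldTheory.Balaban1983to89.Node00.LocalizedSum17 (ReadingMaps Localizes17OfRecord₁₃)
open Literature.MathematicalPhysics.QuantumFieldTheory.Balaban1983to89.Node00.U3OfKernels (histPrefix objectsOfRecord₁₃)
open Literature.MathematicalPhysics.QuantumFieldTheory.Balaban1983to89.Node00.U3KernelLetters (KernelStepRateOfRecord₁₃ PolLimitsExistOfRecord₁₃)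
open YMDAG.UVSplit (N22At RateReading₁₃CoPH rateCarriersOfRecord₁₃CoPH)
open YMDAG.N22.AtKernels (n22At_rateCarriers_of_kernels_pin_of_ne9)
open Literature.Analysis.Complex.SCV (differentiableOn_prod_of_separately)
open Literature.Analysis.Complex (norm_fderiv_le_of_forall_mem_ball_norm_le)

open scoped Matrix.Norms.L2Operator

/-! ## §1 OSGOOD on a product `Dt × ball(0, R)`: continuous + holomorphic in the coupling at each field + holomorphic in the field at each coupling ⟹ jointly holomorphic -/

section Osgood

variable {P : Type*} [NormedAddCommGroup P] [NormedSpace ℂ P] [FiniteDimensional ℂ P]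

/-- **OSGOOD's LEMMA on an open product `Dt × ball(0, R)`** (`P` a finite-dimensional complex normed space): a function `g : ℂ × P → ℂ` CONTINUOUS on the product, holomorphic in
`τ ∈ Dt` for every `v` in the ball and holomorphic in `v` in the ball for every `τ ∈ Dt`, is complex-differentiable (jointly) on the product — the tree's
`Literature.Analysis.Complex.SCV.differentiableOn_prod_of_separately` (Cauchy's formula in `τ` + holomorphic parameter integrals) with its slice hypotheses unfolded.
[cite: HormanderSCV1973, §2.2 (Osgood's lemma); folklore] -/
theorem differentiableOn_prod_ball_of_separately {g : ℂ × P → ℂ} {Dt : Set ℂ} (hDt : IsOpen Dt) {R : ℝ}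
    (hc : ContinuousOn g (Dt ×ˢ ball (0 : P) R))
    (ht : ∀ v ∈ ball (0 : P) R, DifferentiableOn ℂ (fun τ => g (τ, v)) Dt)
    (hv : ∀ τ ∈ Dt, DifferentiableOn ℂ (fun v => g (τ, v)) (ball (0 : P) R)) :
    DifferentiableOn ℂ g (Dt ×ˢ ball (0 : P) R) :=
  differentiableOn_prod_of_separately (hDt.prod isOpen_ball) hc
    (fun q hq => ((ht q.2 (Set.mem_prod.1 hq).2) q.1 (Set.mem_prod.1 hq).1).differentiableAt (hDt.mem_nhds (Set.mem_prod.1 hq).1))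
    (fun t p hp => (((hv t (Set.mem_prod.1 hp).1) p (Set.mem_prod.1 hp).2).mono fun _ hq => (Set.mem_prod.1 hq).2))

omit [FiniteDimensional ℂ P] in
/-- **BOUNDED + SEPARATELY HOLOMORPHIC ⟹ JOINTLY CONTINUOUS** on `Dt × ball(0, R)` (Osgood's own setting, Math. Ann. 52 (1899)): the Cauchy estimate
(`Literature.Analysis.Complex.norm_fderiv_le_of_forall_mem_ball_norm_le`) makes the `τ`-slices UNIFORMLY Lipschitz near `τ₀`, and the `v`-slice at `τ₀` is continuous — so the
continuity hypothesis of the tree's Osgood lemma is FREE for charts carrying the (2.38) bound. [cite: HormanderSCV1973, §2.2 (Osgood's lemma); folklore] -/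
theorem continuousOn_prod_ball_of_separately_of_bound {g : ℂ × P → ℂ} {Dt : Set ℂ} (hDt : IsOpen Dt) {R M : ℝ}
    (ht : ∀ v ∈ ball (0 : P) R, DifferentiableOn ℂ (fun τ => g (τ, v)) Dt)
    (hv : ∀ τ ∈ Dt, DifferentiableOn ℂ (fun v => g (τ, v)) (ball (0 : P) R))
    (hM : ∀ p ∈ Dt ×ˢ ball (0 : P) R, ‖g p‖ ≤ M) :
    ContinuousOn g (Dt ×ˢ ball (0 : P) R) := by
  rintro ⟨τ₀, v₀⟩ ⟨hτ₀, hv₀⟩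
  have hτ₀' : τ₀ ∈ Dt := hτ₀
  have hv₀' : v₀ ∈ ball (0 : P) R := hv₀
  obtain ⟨ε, hε, hεD⟩ := Metric.isOpen_iff.1 hDt τ₀ hτ₀'
  have hM0 : 0 ≤ M := (norm_nonneg _).trans (hM (τ₀, v₀) ⟨hτ₀', hv₀'⟩)
  set L : ℝ := 2 * M / (ε / 2) with hL
  have hL0 : 0 ≤ L := by positivity
  -- the `τ`-slices are `L`-Lipschitz on `ball τ₀ (ε/2)`, uniformly in `v`
  have hball : ∀ x ∈ ball τ₀ (ε / 2), ball x (ε / 2) ⊆ Dt := fun x hx y hy => hεD (by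
    rw [mem_ball] at hx hy ⊢
    calc dist y τ₀ ≤ dist y x + dist x τ₀ := dist_triangle _ _ _
      _ < ε / 2 + ε / 2 := add_lt_add hy hx
      _ = ε := by ring)
  have hLip : ∀ v ∈ ball (0 : P) R, ∀ τ ∈ ball τ₀ (ε / 2), ‖g (τ, v) - g (τ₀, v)‖ ≤ L * ‖τ - τ₀‖ := by
    intro v hvB τ hτ
    have hdiff : ∀ x ∈ ball τ₀ (ε / 2), DifferentiableAt ℂ (fun τ => g (τ, v)) x := fun x hx =>
      (ht v hvB).differentiableAt (hDt.mem_nhds (hball x hx (mem_ball_self (half_pos hε))))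
    have hbound : ∀ x ∈ ball τ₀ (ε / 2), ‖fderiv ℂ (fun τ => g (τ, v)) x‖ ≤ L := fun x hx =>
      norm_fderiv_le_of_forall_mem_ball_norm_le (half_pos hε) ((ht v hvB).mono (hball x hx)) fun w hw => hM (w, v) ⟨hball x hx hw, hvB⟩
    exact (convex_ball τ₀ (ε / 2)).norm_image_sub_le_of_norm_fderiv_le hdiff hbound (mem_ball_self (half_pos hε)) hτ
  -- the `v`-slice at `τ₀` is continuous at `v₀`
  have hcv : ContinuousAt (fun v => g (τ₀, v)) v₀ := (hv τ₀ hτ₀').continuousOn.continuousAt (isOpen_ball.mem_nhds hv₀')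
  -- assemble an `ε–δ` estimate
  rw [ContinuousWithinAt, Metric.tendsto_nhdsWithin_nhds]
  intro e he
  obtain ⟨δ₁, hδ₁, hδ₁'⟩ := Metric.continuousAt_iff.1 hcv (e / 2) (half_pos he)
  refine ⟨min (ε / 2) (min δ₁ ((e / 2) / (L + 1))), by positivity, ?_⟩
  rintro ⟨τ, v⟩ ⟨hτD, hvB⟩ hdist
  have hτv : dist τ τ₀ ≤ dist (τ, v) (τ₀, v₀) ∧ dist v v₀ ≤ dist (τ, v) (τ₀, v₀) := by
    rw [Prod.dist_eq]; exact ⟨le_max_left _ _, le_max_right _ _⟩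
  have h1 : τ ∈ ball τ₀ (ε / 2) := lt_of_le_of_lt hτv.1 (lt_of_lt_of_le hdist (min_le_left _ _))
  have h2 : dist v v₀ < δ₁ := lt_of_le_of_lt hτv.2 (lt_of_lt_of_le hdist ((min_le_right _ _).trans (min_le_left _ _)))
  have h3 : ‖τ - τ₀‖ ≤ (e / 2) / (L + 1) := by
    rw [← dist_eq_norm]; exact hτv.1.trans (hdist.le.trans ((min_le_right _ _).trans (min_le_right _ _)))
  have hA : ‖g (τ, v) - g (τ₀, v)‖ ≤ e / 2 * (L / (L + 1)) :=
    calc ‖g (τ, v) - g (τ₀, v)‖ ≤ L * ‖τ - τ₀‖ := hLip v hvB τ h1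
      _ ≤ L * ((e / 2) / (L + 1)) := mul_le_mul_of_nonneg_left h3 hL0
      _ = e / 2 * (L / (L + 1)) := by ring
  have hfrac : L / (L + 1) < 1 := (div_lt_one (by positivity)).2 (lt_add_one L)
  have hB : dist (g (τ₀, v)) (g (τ₀, v₀)) < e / 2 := hδ₁' h2
  calc dist (g (τ, v)) (g (τ₀, v₀)) ≤ dist (g (τ, v)) (g (τ₀, v)) + dist (g (τ₀, v)) (g (τ₀, v₀)) := dist_triangle _ _ _
    _ < e / 2 + e / 2 := by
        refine add_lt_add_of_le_of_lt ?_ hB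
        rw [dist_eq_norm]
        exact hA.trans (by nlinarith [he])
    _ = e := by ring

/-- **OSGOOD WITH THE BOUND IN PLACE OF CONTINUITY** on `Dt × ball(0, R)`: separately holomorphic + bounded ⟹ jointly holomorphic. [cite: HormanderSCV1973, §2.2; folklore] -/
theorem differentiableOn_prod_ball_of_separately_of_bound {g : ℂ × P → ℂ} {Dt : Set ℂ} (hDt : IsOpen Dt) {R M : ℝ}
    (ht : ∀ v ∈ ball (0 : P) R, DifferentiableOn ℂ (fun τ => g (τ, v)) Dt)
    (hv : ∀ τ ∈ Dt, DifferentiableOn ℂ (fun v => g (τ, v)) (ball (0 : P) R))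
    (hM : ∀ p ∈ Dt ×ˢ ball (0 : P) R, ‖g p‖ ≤ M) :
    DifferentiableOn ℂ g (Dt ×ˢ ball (0 : P) R) :=
  differentiableOn_prod_ball_of_separately hDt (continuousOn_prod_ball_of_separately_of_bound hDt ht hv hM) ht hv

end Osgood

/-! ## §2 C6 §2 FROM SEPARATELY HOLOMORPHIC, JOINTLY CONTINUOUS ACTIVITY CHARTS -/

section Tower

variable (F : T4Family) {𝔄 : Type*} [NormedRing 𝔄] [NormedAlgebra ℝ 𝔄] {V : Type*} [NormedAddCommGroup V] [NormedSpace ℝ V] {𝔸 : Type*} {M : ℕ}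

open Classical in
/-- ★★ **PER-TERM JOINT (coupling, field) OUTPUT CHARTS WITH THE (1.18)-TYPE BOUND FROM SEPARATELY HOLOMORPHIC ACTIVITY CHARTS.**  As C6 §2 `jointCharts_of_activityJointCharts`,
but the activity charts `ℋ K k h m X Z : ℂ × Ec K k → ℂ` are only asked to be holomorphic in the YOUNG COUPLING `τ ∈ Dt` at every complex probe
field of the ball ([I] p. 263 ∕ p. 266 «analytic functions of the effective coupling constants», read on complex probe fields) and holomorphic in the FIELD on the ball at every
coupling of `Dt` ([II] p. 15 «the activities … are analytic functions of (𝐔, 𝐉)») — joint continuity being FREE from the (2.38) bound (§1) — the complexified probe spaces `Ec K k`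
being FINITE-DIMENSIONAL (finitely many sites): OSGOOD (§1) gives the joint charts and C6 §2 the three OUTPUT-chart binders `h𝒢 ∕ hM𝒢 ∕ hf` for `𝒢 := locE ∘ ℋ`, letters `(e·9·64·K₀(64,8)²·A, r₁)`. [folklore] -/
theorem jointCharts_of_activitySepCharts (S : (K : ℕ) → ClusterTower (F.P K) 𝔸 M) (emb : ReadingMaps F 𝔄 𝔸) (ρ : V →L[ℝ] 𝔄) {γ R A Ra r₁ : ℝ}
    (hA : 0 ≤ A) (hr₁ : 0 ≤ r₁) (hrate : r₁ + 2 * (64 * Real.log 162) + 2 ≤ Ra) (hsmall : A * Real.exp (5 * r₁ + 1) * K₀ 64 8 * 9 * 64 ≤ 1)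
    (Ec : ℕ → ℕ → Type*) [∀ K k, NormedAddCommGroup (Ec K k)] [∀ K k, NormedSpace ℂ (Ec K k)] [∀ K k, FiniteDimensional ℂ (Ec K k)]
    (ι : (K k : ℕ) → (domSys (F.P K) M (k + 1)).Dom → ((Fin (F.P K).d → Site (F.P K) (k + 1) → V) →L[ℝ] Ec K k))
    {Dt : Set ℂ} (hDt : IsOpen Dt)
    (ℋ : (K k : ℕ) → (ℕ → ℝ) → ℕ → (domSys (F.P K) M (k + 1)).Dom → (domSys (F.P K) M (k + 1)).Dom → ℂ × Ec K k → ℂ)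
    (hℋτ : ∀ (K k : ℕ), ∀ h ∈ Window γ, ∀ (m : ℕ) (X Z : (domSys (F.P K) M (k + 1)).Dom), Z.1 ⊆ X.1 → ∀ v ∈ ball (0 : Ec K k) R,
      DifferentiableOn ℂ (fun τ => ℋ K k h m X Z (τ, v)) Dt)
    (hℋv : ∀ (K k : ℕ), ∀ h ∈ Window γ, ∀ (m : ℕ) (X Z : (domSys (F.P K) M (k + 1)).Dom), Z.1 ⊆ X.1 → ∀ τ ∈ Dt,
      DifferentiableOn ℂ (fun v => ℋ K k h m X Z (τ, v)) (ball (0 : Ec K k) R))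
    (hMℋ : ∀ (K k : ℕ), ∀ h ∈ Window γ, ∀ (m : ℕ) (X Z : (domSys (F.P K) M (k + 1)).Dom), Z.1 ⊆ X.1 → ∀ p ∈ Dt ×ˢ ball (0 : Ec K k) R,
      ‖ℋ K k h m X Z p‖ ≤ A * Real.exp (-(Ra * (domSys (F.P K) M (k + 1)).dj Z)))
    (hfℋ : ∀ (K k : ℕ), ∀ h ∈ Window γ, ∀ (m : ℕ) (X Z : (domSys (F.P K) M (k + 1)).Dom), Z.1 ⊆ X.1 → ∀ t ∈ Ioc (0 : ℝ) γ,
      ∀ Bf : Fin (F.P K).d → Site (F.P K) (k + 1) → V,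
        ℋ K k h m X Z (t, ι K k X Bf) = ((S K) k).H (histPrefix (Function.update h m t) k) (emb K k (fun l s => NormedSpace.exp (ρ (Bf l s)))) Z) :
    (∀ (K k : ℕ), ∀ h ∈ Window γ, ∀ (m : ℕ) (X : (domSys (F.P K) M (k + 1)).Dom),
      DifferentiableOn ℂ (fun p : ℂ × Ec K k => locE (TTouch (d := 4) (N := domCount (F.P K) M (k + 1))) (fun Z : (domSys (F.P K) M (k + 1)).Dom => Z.1)
        (fun Z => ℋ K k h m X Z p) X.1) (Dt ×ˢ ball (0 : Ec K k) R)) ∧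
    (∀ (K k : ℕ), ∀ h ∈ Window γ, ∀ (m : ℕ) (X : (domSys (F.P K) M (k + 1)).Dom), ∀ p ∈ Dt ×ˢ ball (0 : Ec K k) R,
      ‖locE (TTouch (d := 4) (N := domCount (F.P K) M (k + 1))) (fun Z : (domSys (F.P K) M (k + 1)).Dom => Z.1) (fun Z => ℋ K k h m X Z p) X.1‖ ≤
        (Real.exp 1 * 9 * 64 * K₀ 64 8 ^ 2 * A) * Real.exp (-(r₁ * (domSys (F.P K) M (k + 1)).dj X))) ∧
    (∀ (K k : ℕ), ∀ h ∈ Window γ, ∀ (m : ℕ) (X : (domSys (F.P K) M (k + 1)).Dom), ∀ t ∈ Ioc (0 : ℝ) γ,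
      ∀ Bf : Fin (F.P K).d → Site (F.P K) (k + 1) → V,
        locE (TTouch (d := 4) (N := domCount (F.P K) M (k + 1))) (fun Z : (domSys (F.P K) M (k + 1)).Dom => Z.1)
            (fun Z => ℋ K k h m X Z ((t : ℂ), ι K k X Bf)) X.1 =
          ((S K) k).E (histPrefix (Function.update h m t) k) (emb K k (fun l s => NormedSpace.exp (ρ (Bf l s)))) X) := by
  have hℋ : ∀ (K k : ℕ), ∀ h ∈ Window γ, ∀ (m : ℕ) (X Z : (domSys (F.P K) M (k + 1)).Dom), Z.1 ⊆ X.1 →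
      DifferentiableOn ℂ (ℋ K k h m X Z) (Dt ×ˢ ball (0 : Ec K k) R) := fun K k h hh m X Z hZ =>
    differentiableOn_prod_ball_of_separately_of_bound hDt (hℋτ K k h hh m X Z hZ) (hℋv K k h hh m X Z hZ) (hMℋ K k h hh m X Z hZ)
  exact jointCharts_of_activityJointCharts F S emb ρ hA hr₁ hrate hsmall Ec ι hDt ℋ hℋ hMℋ hfℋ

end Tower

/-! ## §3 AT THE RECORD: K3 §2b's `h9` on the analytic road from SEPARATELY holomorphic activity charts -/

section Record

variable (F : T4Family) (N : ℕ) [NeZero N] {𝔸 : Type*} {M : ℕ}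

open Classical in
/-- ★★★ **K3 §2b's `h9` WITH THE RECORD's GEOMETRIC MODULI ON THE ANALYTIC ROAD, FROM SEPARATELY HOLOMORPHIC ACTIVITY CHARTS.**  As C6 §3
`ne9_EA_objectsOfRecord₁₃_of_kernelStepRate_activityJointCharts` with its activity-chart binder WEAKENED: the charts `ℋ` are asked to be jointly CONTINUOUS and SEPARATELY
holomorphic (coupling at each complex probe field, field at each coupling — Osgood, `Ec K k` finite-dimensional) instead of jointly holomorphic: N18's `KernelStepRateOfRecord₁₃`, the
uniform decay, (1.21), W1-20's law, the separately-holomorphic activity charts with (2.38) on `Dt × ball(0,R)`, Road 1's numerals, reality at real data, probe readings with tails,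
rows ⟹ **`NE9 ((objectsOfRecord₁₃ F N θ ℓ).EA 0) (Window θ.γ) ℓ.κ ℓ.moduli`** (§2 + C4 §3).  THE N22 ROW SENTENCE, analytic road, in the SEPARATE currency: «N18's kernel step rate +
uniform decay + (1.21) + W1-20's law + activity charts analytic in each young coupling and in the field SEPARATELY, with (2.38) + Road 1's numerals + reality + tails + rows ⇒ `h9` with the
record's geometric moduli».  LOCATED (hypothesis form); N22 NOT discharged. [folklore] -/
theorem ne9_EA_objectsOfRecord₁₃_of_kernelStepRate_activitySepCharts (θ : Stage13Params F N) (ℓ : U3Letters₁₁) (hs : ℓ.Signs) (hγ : 0 < θ.γ)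
    (hlim : PolLimitsExistOfRecord₁₃ F N θ) {κ₅ κd C₅ E₀ : ℝ} (hC₅ : 0 ≤ C₅) (hE₀ : 0 < E₀)
    (h5 : KernelStepRateOfRecord₁₃ F N θ κ₅ ℓ.θ₅ C₅) (hdec : DecayBound ((objectsOfRecord₁₃ F N θ ℓ).EA 0) (Window θ.γ) E₀ κd)
    (m' : ℕ) (M : ℕ) [NeZero M] (hM : M = F.L ^ m')
    (S : (K : ℕ) → ClusterTower (F.P K) 𝔸 M) (emb : ReadingMaps F (MatA N) 𝔸) (hloc : Localizes17OfRecord₁₃ F N θ S emb)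
    {κ δ₀ B₃ R r₀ s A Ra r₁ : ℝ} (hR : 0 < R) (hκ₀ : kappa₀ (4 * 2 ^ 4) (2 * 4) ≤ κ / 2) (hδ₀ : 0 < δ₀) (hB₃ : 0 ≤ B₃)
    (hA : 0 ≤ A) (hr₁ : 0 ≤ r₁) (hrate : r₁ + 2 * (64 * Real.log 162) + 2 ≤ Ra) (hsmall : A * Real.exp (5 * r₁ + 1) * K₀ 64 8 * 9 * 64 ≤ 1) (hκE : κ ≤ r₁)
    (hr₀ : 0 < r₀) (hs0 : 0 < s) (hs1 : s < 1)
    (Ec : ℕ → ℕ → Type*) [∀ K k, NormedAddCommGroup (Ec K k)] [∀ K k, NormedSpace ℂ (Ec K k)] [∀ K k, FiniteDimensional ℂ (Ec K k)]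
    (ι : letI := θ.instVβ₁; letI := θ.instVβ₂
      (K k : ℕ) → (domSys (F.P K) M (k + 1)).Dom → ((Fin (F.P K).d → Site (F.P K) (k + 1) → θ.Vβ) →L[ℝ] Ec K k))
    {Dt : Set ℂ} (hDt : IsOpen Dt) (hdisc : ∀ t ∈ Ioc (0 : ℝ) θ.γ, closedBall (t : ℂ) r₀ ⊆ Dt)
    (ℋ : (K k : ℕ) → (ℕ → ℝ) → ℕ → (domSys (F.P K) M (k + 1)).Dom → (domSys (F.P K) M (k + 1)).Dom → ℂ × Ec K k → ℂ)
    (hℋτ : ∀ (K k : ℕ), ∀ h ∈ Window θ.γ, ∀ (m : ℕ) (X Z : (domSys (F.P K) M (k + 1)).Dom), Z.1 ⊆ X.1 → ∀ v ∈ ball (0 : Ec K k) R,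
      DifferentiableOn ℂ (fun τ => ℋ K k h m X Z (τ, v)) Dt)
    (hℋv : ∀ (K k : ℕ), ∀ h ∈ Window θ.γ, ∀ (m : ℕ) (X Z : (domSys (F.P K) M (k + 1)).Dom), Z.1 ⊆ X.1 → ∀ τ ∈ Dt,
      DifferentiableOn ℂ (fun v => ℋ K k h m X Z (τ, v)) (ball (0 : Ec K k) R))
    (hMℋ : ∀ (K k : ℕ), ∀ h ∈ Window θ.γ, ∀ (m : ℕ) (X Z : (domSys (F.P K) M (k + 1)).Dom), Z.1 ⊆ X.1 → ∀ p ∈ Dt ×ˢ ball (0 : Ec K k) R,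
      ‖ℋ K k h m X Z p‖ ≤ A * Real.exp (-(Ra * (domSys (F.P K) M (k + 1)).dj Z)))
    (hfℋ : letI := θ.instVβ₁; letI := θ.instVβ₂
      ∀ (K k : ℕ), ∀ h ∈ Window θ.γ, ∀ (m : ℕ) (X Z : (domSys (F.P K) M (k + 1)).Dom), Z.1 ⊆ X.1 → ∀ t ∈ Ioc (0 : ℝ) θ.γ,
        ∀ Bf : Fin (F.P K).d → Site (F.P K) (k + 1) → θ.Vβ,
          ℋ K k h m X Z (t, ι K k X Bf) = ((S K) k).H (histPrefix (Function.update h m t) k) (emb K k (fun l u => NormedSpace.exp (θ.ρ8 (Bf l u)))) Z)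
    (hIm : letI := θ.instVβ₁; letI := θ.instVβ₂
      ∀ (K k : ℕ), ∀ h ∈ Window θ.γ, ∀ (m : ℕ) (X : (domSys (F.P K) M (k + 1)).Dom), ∀ t ∈ Ioc (0 : ℝ) θ.γ,
        ∀ Bf : Fin (F.P K).d → Site (F.P K) (k + 1) → θ.Vβ,
          (((S K) k).E (histPrefix (Function.update h m t) k) (emb K k (fun l u => NormedSpace.exp (θ.ρ8 (Bf l u)))) X).im = 0)
    (w : (K k : ℕ) → (domSys (F.P K) M (k + 1)).Dom → Site (F.P K) (k + 1) → ℝ) (hw₀ : ∀ K k X t, 0 ≤ w K k X t)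
    (hw : letI := θ.instVβ₁; letI := θ.instVβ₂; letI := θ.instιβ
      ∀ (K k : ℕ) (X : (domSys (F.P K) M (k + 1)).Dom) (l : Fin (F.P K).d) (t : Site (F.P K) (k + 1)) (c : θ.ιβ),
        ‖ι K k X (Pi.single l (Pi.single t (θ.bV c)))‖ ≤ w K k X t)
    (htail : ∀ (K k : ℕ) (X : (domSys (F.P K) M (k + 1)).Dom) (t : Site (F.P K) (k + 1)),
      let e : Site (F.P K) (k + 1) → TPt 4 (domCount (F.P K) M (k + 1) * M) := fun x i => (ZMod.cast (x i) : ZMod (domCount (F.P K) M (k + 1) * M))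
      w K k X t ≤ B₃ * Real.exp (-δ₀ * distCT (domCount (F.P K) M (k + 1)) M (e t) (nearT (M := M) (e t) X)))
    (hκ₅ : delta1 δ₀ κ ((M : ℝ) * 4) ≤ κ₅) (hκd : delta1 δ₀ κ ((M : ℝ) * 4) ≤ κd)
    (hτω : ℓ.θ₅ ^ (1 - s) ≤ ℓ.ω) (hℓκ : ℓ.κ ≤ delta1 δ₀ κ ((M : ℝ) * 4))
    (hC₉ : 32 / (s ^ 2 * min (r₀ / 2) (θ.γ / 2)) * ((2 * (2 * C₅ / (1 - ℓ.θ₅) + 2 * E₀)) ^ (1 - s) *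
        (2 * ((16 * (Real.exp 1 * 9 * 64 * K₀ 64 8 ^ 2 * A) * B₃ ^ 2 / R ^ 2) * Real.exp (delta1 δ₀ κ ((M : ℝ) * 4) * ((M : ℝ) * 4) * 3) * K₀ (4 * 2 ^ 4) (2 * 4) * K₁ 4 (δ₀ / 2) +
          (2 * C₅ / (1 - ℓ.θ₅) + 2 * E₀))) ^ s) / ℓ.θ₅ ^ (1 - s) ≤ ℓ.C₉) :
    NE9 ((objectsOfRecord₁₃ F N θ ℓ).EA 0) (Window θ.γ) ℓ.κ ℓ.moduli := by
  letI := θ.instVβ₁; letI := θ.instVβ₂; letI := θ.instιβ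
  have hB : (0 : ℝ) ≤ Real.exp 1 * 9 * 64 * K₀ 64 8 ^ 2 * A := by have := K₀_pos 64 8; positivity
  obtain ⟨h𝒢, hM𝒢, hf⟩ := jointCharts_of_activitySepCharts F S emb θ.ρ8 hA hr₁ hrate hsmall Ec ι hDt ℋ hℋτ hℋv hMℋ hfℋ
  exact ne9_EA_objectsOfRecord₁₃_of_kernelStepRate_jointCharts F N θ ℓ hs hγ hlim hC₅ hE₀ h5 hdec m' M hM S emb hloc hR hκ₀ hδ₀ hB₃ hB hκE hr₀ hs0 hs1 Ec ι hDt
    hdisc (fun K k h m X p => locE (TTouch (d := 4) (N := domCount (F.P K) M (k + 1))) (fun Z : (domSys (F.P K) M (k + 1)).Dom => Z.1) (fun Z => ℋ K k h m X Z p) X.1)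
    h𝒢 hM𝒢 hf hIm w hw₀ hw htail hκ₅ hκd hτω hℓκ hC₉

open Classical in
/-- ★★★ **PIN FACE — THE N22 ROW OF K3⁸ ON THE ANALYTIC ROAD FROM SEPARATELY HOLOMORPHIC ACTIVITY CHARTS**: `N22At (rateCarriersOfRecord₁₃CoPH 𝔯 F θ hP g₀ os k).u3`
for every `k` under the node-U3 pin `hpin` — §3 composed with dag-n22-w3's `n22At_rateCarriers_of_kernels_pin_of_ne9`.  LOCATED; N22 NOT discharged; nothing of [I]∕[II] asserted.
[folklore] -/
theorem n22At_rateCarriers_of_kernels_pin_of_kernelStepRate_activitySepCharts (𝔯 : RateReading₁₃CoPH N) (θ : Stage13HParams F N) (hP : θ.Provisos₁₃CoPH F N)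
    (g₀ : ℕ → ℝ) (os : List (ULoop F)) (ℓ : U3Letters₁₁) (hs : ℓ.Signs) (hγ : 0 < θ.γ)
    (hpin : (𝔯.lit F θ hP g₀ os).u3 = objectsOfRecord₁₃ F N θ.toStage13Params ℓ)
    (hlim : PolLimitsExistOfRecord₁₃ F N θ.toStage13Params) {κ₅ κd C₅ E₀ : ℝ} (hC₅ : 0 ≤ C₅) (hE₀ : 0 < E₀)
    (h5 : KernelStepRateOfRecord₁₃ F N θ.toStage13Params κ₅ ℓ.θ₅ C₅) (hdec : DecayBound ((objectsOfRecord₁₃ F N θ.toStage13Params ℓ).EA 0) (Window θ.γ) E₀ κd)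
    (m' : ℕ) (M : ℕ) [NeZero M] (hM : M = F.L ^ m')
    (S : (K : ℕ) → ClusterTower (F.P K) 𝔸 M) (emb : ReadingMaps F (MatA N) 𝔸) (hloc : Localizes17OfRecord₁₃ F N θ.toStage13Params S emb)
    {κ δ₀ B₃ R r₀ s A Ra r₁ : ℝ} (hR : 0 < R) (hκ₀ : kappa₀ (4 * 2 ^ 4) (2 * 4) ≤ κ / 2) (hδ₀ : 0 < δ₀) (hB₃ : 0 ≤ B₃)
    (hA : 0 ≤ A) (hr₁ : 0 ≤ r₁) (hrate : r₁ + 2 * (64 * Real.log 162) + 2 ≤ Ra) (hsmall : A * Real.exp (5 * r₁ + 1) * K₀ 64 8 * 9 * 64 ≤ 1) (hκE : κ ≤ r₁)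
    (hr₀ : 0 < r₀) (hs0 : 0 < s) (hs1 : s < 1)
    (Ec : ℕ → ℕ → Type*) [∀ K k, NormedAddCommGroup (Ec K k)] [∀ K k, NormedSpace ℂ (Ec K k)] [∀ K k, FiniteDimensional ℂ (Ec K k)]
    (ι : letI := θ.instVβ₁; letI := θ.instVβ₂
      (K k : ℕ) → (domSys (F.P K) M (k + 1)).Dom → ((Fin (F.P K).d → Site (F.P K) (k + 1) → θ.Vβ) →L[ℝ] Ec K k))
    {Dt : Set ℂ} (hDt : IsOpen Dt) (hdisc : ∀ t ∈ Ioc (0 : ℝ) θ.γ, closedBall (t : ℂ) r₀ ⊆ Dt)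
    (ℋ : (K k : ℕ) → (ℕ → ℝ) → ℕ → (domSys (F.P K) M (k + 1)).Dom → (domSys (F.P K) M (k + 1)).Dom → ℂ × Ec K k → ℂ)
    (hℋτ : ∀ (K k : ℕ), ∀ h ∈ Window θ.γ, ∀ (m : ℕ) (X Z : (domSys (F.P K) M (k + 1)).Dom), Z.1 ⊆ X.1 → ∀ v ∈ ball (0 : Ec K k) R,
      DifferentiableOn ℂ (fun τ => ℋ K k h m X Z (τ, v)) Dt)
    (hℋv : ∀ (K k : ℕ), ∀ h ∈ Window θ.γ, ∀ (m : ℕ) (X Z : (domSys (F.P K) M (k + 1)).Dom), Z.1 ⊆ X.1 → ∀ τ ∈ Dt,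
      DifferentiableOn ℂ (fun v => ℋ K k h m X Z (τ, v)) (ball (0 : Ec K k) R))
    (hMℋ : ∀ (K k : ℕ), ∀ h ∈ Window θ.γ, ∀ (m : ℕ) (X Z : (domSys (F.P K) M (k + 1)).Dom), Z.1 ⊆ X.1 → ∀ p ∈ Dt ×ˢ ball (0 : Ec K k) R,
      ‖ℋ K k h m X Z p‖ ≤ A * Real.exp (-(Ra * (domSys (F.P K) M (k + 1)).dj Z)))
    (hfℋ : letI := θ.instVβ₁; letI := θ.instVβ₂
      ∀ (K k : ℕ), ∀ h ∈ Window θ.γ, ∀ (m : ℕ) (X Z : (domSys (F.P K) M (k + 1)).Dom), Z.1 ⊆ X.1 → ∀ t ∈ Ioc (0 : ℝ) θ.γ,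
        ∀ Bf : Fin (F.P K).d → Site (F.P K) (k + 1) → θ.Vβ,
          ℋ K k h m X Z (t, ι K k X Bf) = ((S K) k).H (histPrefix (Function.update h m t) k) (emb K k (fun l u => NormedSpace.exp (θ.ρ8 (Bf l u)))) Z)
    (hIm : letI := θ.instVβ₁; letI := θ.instVβ₂
      ∀ (K k : ℕ), ∀ h ∈ Window θ.γ, ∀ (m : ℕ) (X : (domSys (F.P K) M (k + 1)).Dom), ∀ t ∈ Ioc (0 : ℝ) θ.γ,
        ∀ Bf : Fin (F.P K).d → Site (F.P K) (k + 1) → θ.Vβ,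
          (((S K) k).E (histPrefix (Function.update h m t) k) (emb K k (fun l u => NormedSpace.exp (θ.ρ8 (Bf l u)))) X).im = 0)
    (w : (K k : ℕ) → (domSys (F.P K) M (k + 1)).Dom → Site (F.P K) (k + 1) → ℝ) (hw₀ : ∀ K k X t, 0 ≤ w K k X t)
    (hw : letI := θ.instVβ₁; letI := θ.instVβ₂; letI := θ.instιβ
      ∀ (K k : ℕ) (X : (domSys (F.P K) M (k + 1)).Dom) (l : Fin (F.P K).d) (t : Site (F.P K) (k + 1)) (c : θ.ιβ),
        ‖ι K k X (Pi.single l (Pi.single t (θ.bV c)))‖ ≤ w K k X t)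
    (htail : ∀ (K k : ℕ) (X : (domSys (F.P K) M (k + 1)).Dom) (t : Site (F.P K) (k + 1)),
      let e : Site (F.P K) (k + 1) → TPt 4 (domCount (F.P K) M (k + 1) * M) := fun x i => (ZMod.cast (x i) : ZMod (domCount (F.P K) M (k + 1) * M))
      w K k X t ≤ B₃ * Real.exp (-δ₀ * distCT (domCount (F.P K) M (k + 1)) M (e t) (nearT (M := M) (e t) X)))
    (hκ₅ : delta1 δ₀ κ ((M : ℝ) * 4) ≤ κ₅) (hκd : delta1 δ₀ κ ((M : ℝ) * 4) ≤ κd)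
    (hτω : ℓ.θ₅ ^ (1 - s) ≤ ℓ.ω) (hℓκ : ℓ.κ ≤ delta1 δ₀ κ ((M : ℝ) * 4))
    (hC₉ : 32 / (s ^ 2 * min (r₀ / 2) (θ.γ / 2)) * ((2 * (2 * C₅ / (1 - ℓ.θ₅) + 2 * E₀)) ^ (1 - s) *
        (2 * ((16 * (Real.exp 1 * 9 * 64 * K₀ 64 8 ^ 2 * A) * B₃ ^ 2 / R ^ 2) * Real.exp (delta1 δ₀ κ ((M : ℝ) * 4) * ((M : ℝ) * 4) * 3) * K₀ (4 * 2 ^ 4) (2 * 4) * K₁ 4 (δ₀ / 2) +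
          (2 * C₅ / (1 - ℓ.θ₅) + 2 * E₀))) ^ s) / ℓ.θ₅ ^ (1 - s) ≤ ℓ.C₉)
    (k : ℕ) :
    N22At (rateCarriersOfRecord₁₃CoPH 𝔯 F θ hP g₀ os k).u3 :=
  n22At_rateCarriers_of_kernels_pin_of_ne9 𝔯 θ hP g₀ os ℓ hs hpin
    (ne9_EA_objectsOfRecord₁₃_of_kernelStepRate_activitySepCharts F N θ.toStage13Params ℓ hs hγ hlim hC₅ hE₀ h5 hdec m' M hM S emb hloc hR hκ₀ hδ₀ hB₃ hA hr₁ hrate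
      hsmall hκE hr₀ hs0 hs1 Ec ι hDt hdisc ℋ hℋτ hℋv hMℋ hfℋ hIm w hw₀ hw htail hκ₅ hκd hτω hℓκ hC₉) k

end Record

end YMDAG.N22.JointHoloLocalTerms

end
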